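/-
Copyright (c) 2026. All rights reserved.
Released under Apache 2.0 license as described in the file LICENSE.
Authors: abc-iut cell, Cor. 3.12 sub-crew seat abc-iut-c312-3 (gen 9).
-/
import Literature.IUT.LogVolume.LogSeriesDominantTerm
import HarnessLib

/-!
# The largest norm on `log_p(𝒪_K^×)` in CLOSED FORM: `max ‖log_p u‖ = ‖ϖ‖^{p^{a₀} − a₀·e}`

Proof-only file (theorems, no definitions, no named fact) over abc-iut-S1's `LocalUnitLog.lean`
(`unitLog = log_p` on units, `logUnits K = log_p(𝒪_K^×)`) and `RamificationInvariants.lean`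
(`e = absRamificationIdx p K`, norm uniformizer `ϖ`, `‖p‖ = ‖ϖ‖^e`), built on abc-iut-w5-d017's
dominant-term toolkit `LogSeriesDominantTerm.lean` (exponent arithmetic of `h(a) = p^a − e·a`, turning
point, isosceles read-out).  Setting: `K` ANY proper ultrametric normed `ℚ_p`-algebra field (a finite
extension of `ℚ_p`), ANY prime `p` (`p = 2` included), ANY ramification index `e ≥ 1`.

Classical fact (Neukirch, *Algebraic Number Theory* II (5.5); Koblitz GTM 58 IV §1): for a principal unit
`y = 1 + x`, `‖x‖ = ‖ϖ‖^s`, the term of index `n` of `log_p y = Σ ± xⁿ/n` has norm `‖ϖ‖^{s·n − e·v_p(n)}`;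
over all `n ≥ 1` and `s ≥ 1` the least exponent is the LOWER ENVELOPE

  `β(p, e) := min_{a ≥ 0} (p^a − e·a) = p^{a₀} − e·a₀`,

`a₀` the TURNING POINT (`p^a·(p−1) < e` for `a < a₀`, `e ≤ p^{a₀}·(p−1)`; it exists and the two
inequalities determine it; by convexity of `a ↦ p^a − e·a` it is the minimiser, UNIQUE with an integer gap
as soon as `e < p^{a₀}·(p−1)`, i.e. unless `e = p^{a₀}·(p−1)` is a CYCLOTOMIC INDEX `e(ℚ_p(ζ_{p^{a₀+1}})/ℚ_p)`).
What is proved: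

* §1 turning points: existence (`exists_turning`), the one-step criterion (`forall_lt_of_pred_lt`:
  `p^{a₀−1}(p−1) < e` suffices below), strictness off the cyclotomic indices
  (`lt_of_le_of_forall_ne`, `exists_strict_turning_of_forall_ne`), and the two lowest cases
  `a₀ = 0 ⟺ e ≤ p − 1` (`β = 1`), `a₀ = 1 ⟺ p − 1 < e ≤ p(p−1)` (`β = p − e`).
* §2 **UPPER BOUND, unconditional**: `‖log_p u‖ ≤ ‖ϖ‖^{p^{a₀} − e·a₀}` for EVERY `u : K`
  (`norm_unitLog_le_zpow_envelope`; `norm_logSeries_le_zpow_envelope` for principal units;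
  `logUnits_subset_closedBall_envelope`, `forall_mem_logUnits_norm_le_envelope`).
* §3 **EXACTNESS off the cyclotomic indices**: if `e < p^{a₀}·(p−1)` then for EVERY `y` with
  `‖1 − y‖ = ‖ϖ‖` (e.g. `y = 1 + ϖ`) `‖log_p y‖ = ‖ϖ‖^{p^{a₀} − e·a₀}` EXACTLY — the term of index
  `p^{a₀}` strictly dominates (`norm_logSeries_eq_zpow_envelope`, `norm_unitLog_one_add_eq_zpow_envelope`);
  hence the maximum of `‖·‖` on `log_p(𝒪_K^×)` is ATTAINED and equals `‖ϖ‖^{p^{a₀} − e·a₀}`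
  (`isGreatest_norm_logUnits`, `sSup_norm_logUnits`, `norm_eq_zpow_of_isMaxOn_logUnits`,
  rpow form `norm_eq_rpow_of_isMaxOn_logUnits`: `= p^{−(p^{a₀} − e·a₀)/e}`;
  `logUnits_subset_closedBall_iff`).
* §4 closed forms at the two lowest turning points: `e ≤ p − 1 ⇒ ‖log_p u‖ ≤ ‖ϖ‖` (the content of
  abc-iut-w5-d172's `UnitLogIntoMaximalIdeal`, re-derived), with equality attained when `e < p − 1`;
  **`p − 1 < e ≤ p(p−1) ⇒ ‖log_p u‖ ≤ ‖ϖ‖^{p−e} = p^{1 − p/e}`, attained when `e < p(p−1)`**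
  (`isGreatest_norm_logUnits_of_lt_of_lt`; e.g. `e = p`: a UNIT logarithm, abc-iut-w5-d138's
  `UnitLogWildPrime`; `p = 7, e = 11`: `max ‖log_7 u‖ = 7^{4/11}`).

Consistency with the tree: tame `e ≤ p − 2` gives `‖ϖ‖ = p^{−1/e}` (= abc-iut-w5-d082's
`norm_eq_of_isMaxOn_logUnits_of_tame`); `e ≥ p` gives exponent `≤ 0` (abc-iut-w6-d060's
`UnitLogDeepRamification`: `log_p(𝒪^×) ⊄ 𝔪`); at the ties `e = p^a(p−1)` only the upper bound is
claimed (the value then depends on `K`, e.g. `e = p − 1`: abc-iut-w4's `UnitLogBoundaryRamification*`).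
Comparison with [IUTchIV] Prop. 1.2 (i) (`log_p(R^×) ⊆ p^{−b}·R`, tree `prop12i_holds`): off the ties
`b + 1/e = a₀`, so the container radius is `‖ϖ‖^{1 − e·a₀}` against the exact `‖ϖ‖^{p^{a₀} − e·a₀}` —
the exact radius is `(p^{a₀} − 1)/e` `p`-levels smaller (this comparison is a remark; not used).

Consumer (D-0079 R-W «WINDOW Θ-SIDE INEQUALITY», column «ν_w»; record only): the per-place bound `r` of
abc-iut-w4-d026's `not_licence_settingPrVolSharp_of_explicitDepth_star_radius` (any `r` with
`∀ w ∈ logUnits K_w, ‖w‖ ≤ r`) may be taken to be `‖ϖ_w‖^{p^{a₀} − e_w·a₀}` by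
`forall_mem_logUnits_norm_le_envelope`, and is then OPTIMAL off the cyclotomic indices.  Nothing here is
disputed mathematics; no IUT statement is asserted; nothing bears on [IUTchIII] Cor. 3.12.
-/

noncomputable section

open Metric Set

namespace Literature.IUT.LogVolume

namespace LogEnvelope

open RamificationCriterion Literature.NumberTheory.GaloisRepresentations.Ultrametric

/-! ### §1. Turning points of `a ↦ p^a − e·a` -/

section Arith

variable {p : ℕ} [hp : Fact p.Prime]

/-- **A turning point exists**: for every `e` there is `a₀` with `p^a·(p−1) < e` for all `a < a₀` and
`e ≤ p^{a₀}·(p−1)` (the least `a` with `e ≤ p^a(p−1)`; `a = e` qualifies).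
[cite: NeukirchANT1999, Ch. II (5.5)] -/
theorem exists_turning (e : ℕ) :
    ∃ a₀ : ℕ, (∀ a < a₀, (p : ℤ) ^ a * ((p : ℤ) - 1) < e) ∧ (e : ℤ) ≤ (p : ℤ) ^ a₀ * ((p : ℤ) - 1) := by
  classical
  have hP : (2 : ℤ) ≤ (p : ℤ) := by exact_mod_cast hp.out.two_le
  have hex : ∃ a : ℕ, (e : ℤ) ≤ 1 * (p : ℤ) ^ a * ((p : ℤ) - 1) := exists_le_increment le_rfl hP e
  refine ⟨Nat.find hex, fun a ha => ?_, ?_⟩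
  · have h := Nat.find_min hex ha
    rw [one_mul, not_le] at h
    exact h
  · have h := Nat.find_spec hex
    rwa [one_mul] at h

/-- **One step below suffices**: the increments `p^a·(p−1)` grow with `a`, so `p^{a₀−1}·(p−1) < e`
already gives `p^a·(p−1) < e` for every `a < a₀`. [cite: NeukirchANT1999, Ch. II (5.5)] -/
theorem forall_lt_of_pred_lt {a₀ : ℕ} {e : ℕ} (h : ∀ a : ℕ, a + 1 = a₀ → (p : ℤ) ^ a * ((p : ℤ) - 1) < e) :
    ∀ a < a₀, (p : ℤ) ^ a * ((p : ℤ) - 1) < e := by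
  intro a ha
  have hP : (2 : ℤ) ≤ (p : ℤ) := by exact_mod_cast hp.out.two_le
  obtain ⟨d, rfl⟩ := Nat.exists_eq_add_of_lt ha
  have hmono := increment_mono (S := 1) le_rfl hP (Nat.le_add_right a d)
  have hlast := h (a + d) rfl
  rw [one_mul, one_mul] at hmono
  exact lt_of_le_of_lt hmono hlast

omit hp in
/-- **Off the cyclotomic indices the turning inequality is strict**: if `e ≠ p^a·(p−1)` for every `a`,
then `e ≤ p^{a₀}·(p−1)` is `e < p^{a₀}·(p−1)`. [cite: NeukirchANT1999, Ch. II (5.5)] -/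
theorem lt_of_le_of_forall_ne {a₀ : ℕ} {e : ℕ} (hhi : (e : ℤ) ≤ (p : ℤ) ^ a₀ * ((p : ℤ) - 1))
    (hne : ∀ a : ℕ, (e : ℤ) ≠ (p : ℤ) ^ a * ((p : ℤ) - 1)) : (e : ℤ) < (p : ℤ) ^ a₀ * ((p : ℤ) - 1) :=
  lt_of_le_of_ne hhi (hne a₀)

/-- **A STRICT turning point exists off the cyclotomic indices** `e ∉ {p^a·(p−1)}`.
[cite: NeukirchANT1999, Ch. II (5.5)] -/
theorem exists_strict_turning_of_forall_ne {e : ℕ} (hne : ∀ a : ℕ, (e : ℤ) ≠ (p : ℤ) ^ a * ((p : ℤ) - 1)) :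
    ∃ a₀ : ℕ, (∀ a < a₀, (p : ℤ) ^ a * ((p : ℤ) - 1) < e) ∧ (e : ℤ) < (p : ℤ) ^ a₀ * ((p : ℤ) - 1) := by
  obtain ⟨a₀, hlo, hhi⟩ := exists_turning (p := p) e
  exact ⟨a₀, hlo, lt_of_le_of_forall_ne hhi hne⟩

/-- **The turning point is `0` iff `e ≤ p − 1`** (then the envelope exponent is `p^0 − 0 = 1`).
[cite: NeukirchANT1999, Ch. II (5.5)] -/
theorem turning_zero {e : ℕ} (he : e ≤ p - 1) :
    (∀ a < 0, (p : ℤ) ^ a * ((p : ℤ) - 1) < e) ∧ (e : ℤ) ≤ (p : ℤ) ^ 0 * ((p : ℤ) - 1) := by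
  refine ⟨fun a ha => absurd ha (Nat.not_lt_zero a), ?_⟩
  have h1 : 1 ≤ p := hp.out.one_le
  have : (e : ℤ) ≤ (p : ℤ) - 1 := by
    have := (Int.ofNat_le).mpr he
    push_cast [Nat.cast_sub h1] at this
    exact this
  simpa using this

/-- **The turning point is `1` iff `p − 1 < e ≤ p·(p−1)`** (then the envelope exponent is `p − e`).
[cite: NeukirchANT1999, Ch. II (5.5)] -/
theorem turning_one {e : ℕ} (h1 : p - 1 < e) (h2 : e ≤ p * (p - 1)) :
    (∀ a < 1, (p : ℤ) ^ a * ((p : ℤ) - 1) < e) ∧ (e : ℤ) ≤ (p : ℤ) ^ 1 * ((p : ℤ) - 1) := by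
  have hp1 : 1 ≤ p := hp.out.one_le
  have h1' : (p : ℤ) - 1 < e := by
    have := (Int.ofNat_lt).mpr h1
    push_cast [Nat.cast_sub hp1] at this
    exact this
  have h2' : (e : ℤ) ≤ (p : ℤ) * ((p : ℤ) - 1) := by
    have := (Int.ofNat_le).mpr h2
    push_cast [Nat.cast_sub hp1] at this
    exact this
  refine ⟨fun a ha => ?_, by simpa using h2'⟩
  have ha0 : a = 0 := by omega
  subst ha0
  simpa using h1'

/-- Strict form of `turning_one`: `p − 1 < e < p·(p−1)`. [cite: NeukirchANT1999, Ch. II (5.5)] -/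
theorem strict_turning_one {e : ℕ} (h1 : p - 1 < e) (h2 : e < p * (p - 1)) :
    (∀ a < 1, (p : ℤ) ^ a * ((p : ℤ) - 1) < e) ∧ (e : ℤ) < (p : ℤ) ^ 1 * ((p : ℤ) - 1) := by
  have hp1 : 1 ≤ p := hp.out.one_le
  refine ⟨(turning_one h1 h2.le).1, ?_⟩
  have := (Int.ofNat_lt).mpr h2
  push_cast [Nat.cast_sub hp1] at this
  simpa using this

/-- Strict form of `turning_zero`: `e < p − 1` (the TAME range `e ≤ p − 2`).
[cite: NeukirchANT1999, Ch. II (5.5)] -/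
theorem strict_turning_zero {e : ℕ} (he : e < p - 1) :
    (∀ a < 0, (p : ℤ) ^ a * ((p : ℤ) - 1) < e) ∧ (e : ℤ) < (p : ℤ) ^ 0 * ((p : ℤ) - 1) := by
  refine ⟨(turning_zero he.le).1, ?_⟩
  have h1 : 1 ≤ p := hp.out.one_le
  have := (Int.ofNat_lt).mpr he
  push_cast [Nat.cast_sub h1] at this
  simpa using this

end Arith

/-! ### §2. The upper bound `‖log_p u‖ ≤ ‖ϖ‖^{p^{a₀} − e·a₀}` (every `K`, `p`, `e`) -/

section Field

variable (p : ℕ) [hp : Fact p.Prime]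
variable {K : Type*} [NontriviallyNormedField K] [instK : NormedAlgebra ℚ_[p] K] [IsUltrametricDist K]
  [ProperSpace K]
variable {ϖ : Kˣ} (hϖ : IsUniformizer ϖ)
include hϖ

omit hϖ in
/-- **Every term exponent dominates the envelope**: for `s ≥ 1` and every index `n + 1`,
`p^{a₀} − e·a₀ ≤ s·(n+1) − e·v_p(n+1)` (`s·(n+1) ≥ n+1 ≥ p^a − e·a + …` for the prime-power part
`p^a ∣ n+1`, then the turning point minimises). [cite: NeukirchANT1999, Ch. II (5.5)] -/
theorem envelope_le_index {a₀ : ℕ}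
    (hlo : ∀ a < a₀, (p : ℤ) ^ a * ((p : ℤ) - 1) < absRamificationIdx p K)
    (hhi : (absRamificationIdx p K : ℤ) ≤ (p : ℤ) ^ a₀ * ((p : ℤ) - 1)) {s : ℤ} (hs : 1 ≤ s) (n : ℕ) :
    (p : ℤ) ^ a₀ - (absRamificationIdx p K : ℤ) * (a₀ : ℤ)
      ≤ s * ((n + 1 : ℕ) : ℤ) - (absRamificationIdx p K : ℤ) * (padicValNat p (n + 1) : ℤ) := by
  have hP : (2 : ℤ) ≤ (p : ℤ) := by exact_mod_cast hp.out.two_le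
  obtain ⟨a, ha, -⟩ :=
    exists_exponent_le_index (p := p) (s := 1) le_rfl (absRamificationIdx p K) (Nat.succ_ne_zero n)
  have hmin := exponent_min (S := 1) (P := (p : ℤ)) (E := (absRamificationIdx p K : ℤ)) (a₀ := a₀)
    le_rfl hP (fun b hb => by rw [one_mul]; exact hlo b hb) (by rw [one_mul]; exact hhi) a
  rw [one_mul, one_mul] at hmin
  rw [one_mul, one_mul] at ha
  have hn0 : (0 : ℤ) ≤ ((n + 1 : ℕ) : ℤ) := by positivity
  have hsn : ((n + 1 : ℕ) : ℤ) ≤ s * ((n + 1 : ℕ) : ℤ) := by nlinarith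
  linarith

/-- **`‖L(y)‖ ≤ ‖ϖ‖^{p^{a₀} − e·a₀}` for every principal unit `y`** (`a₀` a turning point of `e`).
[cite: NeukirchANT1999, Ch. II (5.5)] -/
theorem norm_logSeries_le_zpow_envelope {a₀ : ℕ}
    (hlo : ∀ a < a₀, (p : ℤ) ^ a * ((p : ℤ) - 1) < absRamificationIdx p K)
    (hhi : (absRamificationIdx p K : ℤ) ≤ (p : ℤ) ^ a₀ * ((p : ℤ) - 1)) {y : K} (hyP : IsPrincipal y) :
    ‖logSeries y‖ ≤ ‖(ϖ : K)‖ ^ ((p : ℤ) ^ a₀ - (absRamificationIdx p K : ℤ) * (a₀ : ℤ)) := by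
  have hρ0 : 0 < ‖(ϖ : K)‖ := norm_units_pos ϖ
  by_cases hx : 1 - y = 0
  · have hy1 : y = 1 := (sub_eq_zero.mp hx).symm
    rw [hy1, logSeries_one, norm_zero]
    exact (zpow_pos hρ0 _).le
  obtain ⟨s, hs⟩ := hϖ.2 (Units.mk0 (1 - y) hx)
  rw [Units.val_mk0] at hs
  have hs1 : 1 ≤ s := by
    have h1 : ‖(ϖ : K)‖ ^ s < 1 := hs ▸ hyP
    have := (zpow_lt_one_iff_right_of_lt_one₀ hρ0 hϖ.1).mp h1
    omega
  refine norm_logSeries_le (zpow_pos hρ0 _).le fun n => ?_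
  rw [norm_logTerm_eq_zpow p hϖ hs n]
  exact zpow_le_zpow_right_of_le_one₀ hρ0 hϖ.1.le (envelope_le_index p hlo hhi hs1 n)

/-- **`‖log_p u‖ ≤ ‖ϖ‖^{p^{a₀} − e·a₀}` for EVERY `u : K`** (units: `log_p u = m⁻¹·L(u^m)` with `p ∤ m`,
`u^m` principal; non-units: junk value `0`).  The envelope bound; unconditional in `K`, `p`, `e`.
[cite: NeukirchANT1999, Ch. II (5.5)] -/
theorem norm_unitLog_le_zpow_envelope {a₀ : ℕ}
    (hlo : ∀ a < a₀, (p : ℤ) ^ a * ((p : ℤ) - 1) < absRamificationIdx p K)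
    (hhi : (absRamificationIdx p K : ℤ) ≤ (p : ℤ) ^ a₀ * ((p : ℤ) - 1)) (u : K) :
    ‖unitLog u‖ ≤ ‖(ϖ : K)‖ ^ ((p : ℤ) ^ a₀ - (absRamificationIdx p K : ℤ) * (a₀ : ℤ)) := by
  by_cases hu : ‖u‖ = 1
  · obtain ⟨m, hm0, hmp, hmP⟩ := exists_pow_isPrincipal_not_dvd (p := p) hu
    rw [unitLog_eq_inv_mul_logSeries p hm0 hmP, norm_mul, norm_inv,
      norm_natCast_eq_one_of_not_dvd p hmp, inv_one, one_mul]
    exact norm_logSeries_le_zpow_envelope p hϖ hlo hhi hmP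
  · rw [unitLog_of_norm_ne_one hu, norm_zero]
    exact (zpow_pos (norm_units_pos ϖ) _).le

/-- **`log_p(𝒪_K^×) ⊆ {‖z‖ ≤ ‖ϖ‖^{p^{a₀} − e·a₀}}`.** [cite: NeukirchANT1999, Ch. II (5.5)] -/
theorem logUnits_subset_closedBall_envelope {a₀ : ℕ}
    (hlo : ∀ a < a₀, (p : ℤ) ^ a * ((p : ℤ) - 1) < absRamificationIdx p K)
    (hhi : (absRamificationIdx p K : ℤ) ≤ (p : ℤ) ^ a₀ * ((p : ℤ) - 1)) :
    logUnits K ⊆ closedBall (0 : K) (‖(ϖ : K)‖ ^ ((p : ℤ) ^ a₀ - (absRamificationIdx p K : ℤ) * (a₀ : ℤ))) := by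
  rintro z ⟨u, -, rfl⟩
  rw [mem_closedBall_zero_iff]
  exact norm_unitLog_le_zpow_envelope p hϖ hlo hhi u

/-- The same in the form `∀ w ∈ log_p(𝒪_K^×), ‖w‖ ≤ r` consumed by radius-parametrised statements.
[cite: NeukirchANT1999, Ch. II (5.5)] -/
theorem forall_mem_logUnits_norm_le_envelope {a₀ : ℕ}
    (hlo : ∀ a < a₀, (p : ℤ) ^ a * ((p : ℤ) - 1) < absRamificationIdx p K)
    (hhi : (absRamificationIdx p K : ℤ) ≤ (p : ℤ) ^ a₀ * ((p : ℤ) - 1)) :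
    ∀ w ∈ logUnits K, ‖w‖ ≤ ‖(ϖ : K)‖ ^ ((p : ℤ) ^ a₀ - (absRamificationIdx p K : ℤ) * (a₀ : ℤ)) :=
  fun _ hw => mem_closedBall_zero_iff.mp (logUnits_subset_closedBall_envelope p hϖ hlo hhi hw)

/-- **Unconditional existence form**: for every `K` there is a turning point `a₀` of `e(K/ℚ_p)`, and
`‖log_p u‖ ≤ ‖ϖ‖^{p^{a₀} − e·a₀}` for all `u`. [cite: NeukirchANT1999, Ch. II (5.5)] -/
theorem exists_turning_norm_unitLog_le :
    ∃ a₀ : ℕ, (∀ a < a₀, (p : ℤ) ^ a * ((p : ℤ) - 1) < absRamificationIdx p K) ∧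
      (absRamificationIdx p K : ℤ) ≤ (p : ℤ) ^ a₀ * ((p : ℤ) - 1) ∧
      ∀ u : K, ‖unitLog u‖ ≤ ‖(ϖ : K)‖ ^ ((p : ℤ) ^ a₀ - (absRamificationIdx p K : ℤ) * (a₀ : ℤ)) := by
  obtain ⟨a₀, hlo, hhi⟩ := exists_turning (p := p) (absRamificationIdx p K)
  exact ⟨a₀, hlo, hhi, norm_unitLog_le_zpow_envelope p hϖ hlo hhi⟩

/-! ### §3. Exactness at a strict turning point: the term of index `p^{a₀}` dominates -/

/-- **`‖L(y)‖ = ‖ϖ‖^{p^{a₀} − e·a₀}` EXACTLY when `‖1 − y‖ = ‖ϖ‖` and the turning point is strict**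
(`e < p^{a₀}·(p−1)`): the term of index `p^{a₀}` has exponent `p^{a₀} − e·a₀` and every other term has
exponent `≥ p^{a₀} − e·a₀ + 1` (non-prime-power indices by `exists_exponent_le_index`, the other prime
powers by `exponent_min_strict`), so the isosceles principle applies (`norm_logSeries_eq_zpow_of_dominant`).
[cite: NeukirchANT1999, Ch. II (5.5)] -/
theorem norm_logSeries_eq_zpow_envelope {a₀ : ℕ}
    (hlo : ∀ a < a₀, (p : ℤ) ^ a * ((p : ℤ) - 1) < absRamificationIdx p K)
    (hhi : (absRamificationIdx p K : ℤ) < (p : ℤ) ^ a₀ * ((p : ℤ) - 1)) {y : K}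
    (hy : ‖1 - y‖ = ‖(ϖ : K)‖) :
    ‖logSeries y‖ = ‖(ϖ : K)‖ ^ ((p : ℤ) ^ a₀ - (absRamificationIdx p K : ℤ) * (a₀ : ℤ)) := by
  have hP : (2 : ℤ) ≤ (p : ℤ) := by exact_mod_cast hp.out.two_le
  have hyP : IsPrincipal y := by
    show ‖1 - y‖ < 1
    rw [hy]
    exact hϖ.1
  have hs : ‖1 - y‖ = ‖(ϖ : K)‖ ^ (1 : ℤ) := by rw [zpow_one]; exact hy
  set e : ℕ := absRamificationIdx p K with he_def
  have hstrict : ∀ a : ℕ, a ≠ a₀ →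
      (p : ℤ) ^ a₀ - e * (a₀ : ℤ) + 1 ≤ (p : ℤ) ^ a - e * (a : ℤ) := by
    intro a ha
    have h := exponent_min_strict (S := 1) (P := (p : ℤ)) (E := (e : ℤ)) (a₀ := a₀) le_rfl hP
      (fun b hb => by rw [one_mul]; exact hlo b hb) (by rw [one_mul]; exact hhi) ha
    rwa [one_mul, one_mul] at h
  -- the dominant index `n₀ + 1 = p^{a₀}`
  obtain ⟨n₀, hn₀1⟩ : ∃ n₀ : ℕ, n₀ + 1 = p ^ a₀ :=
    ⟨p ^ a₀ - 1, Nat.sub_add_cancel (Nat.one_le_pow _ _ hp.out.pos)⟩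
  have hN₀ : (1 : ℤ) * ((n₀ + 1 : ℕ) : ℤ) - (e : ℤ) * (padicValNat p (n₀ + 1) : ℤ)
      = (p : ℤ) ^ a₀ - e * (a₀ : ℤ) := by
    rw [hn₀1, padicValNat.prime_pow]
    push_cast
    ring
  have hdom : ∀ n : ℕ, n ≠ n₀ → (p : ℤ) ^ a₀ - e * (a₀ : ℤ) + 1
      ≤ 1 * ((n + 1 : ℕ) : ℤ) - (e : ℤ) * (padicValNat p (n + 1) : ℤ) := by
    intro n hn
    obtain ⟨a, ha, ha'⟩ := exists_exponent_le_index (p := p) (s := 1) le_rfl e (Nat.succ_ne_zero n)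
    rw [one_mul] at ha ha'
    by_cases haa : a = a₀
    · have hne : n + 1 ≠ p ^ a := by
        rw [haa, ← hn₀1]
        intro h
        exact hn (by omega)
      have h := ha' hne
      rw [haa] at h
      exact h
    · exact (hstrict a haa).trans ha
  exact norm_logSeries_eq_zpow_of_dominant p hϖ hyP hs n₀ hN₀ hdom

/-- `‖log_p y‖ = ‖ϖ‖^{p^{a₀} − e·a₀}` for every `y` with `‖1 − y‖ = ‖ϖ‖` (strict turning point).
[cite: NeukirchANT1999, Ch. II (5.5)] -/
theorem norm_unitLog_eq_zpow_envelope {a₀ : ℕ}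
    (hlo : ∀ a < a₀, (p : ℤ) ^ a * ((p : ℤ) - 1) < absRamificationIdx p K)
    (hhi : (absRamificationIdx p K : ℤ) < (p : ℤ) ^ a₀ * ((p : ℤ) - 1)) {y : K}
    (hy : ‖1 - y‖ = ‖(ϖ : K)‖) :
    ‖unitLog y‖ = ‖(ϖ : K)‖ ^ ((p : ℤ) ^ a₀ - (absRamificationIdx p K : ℤ) * (a₀ : ℤ)) := by
  have hyP : IsPrincipal y := by
    show ‖1 - y‖ < 1
    rw [hy]
    exact hϖ.1
  rw [unitLog_of_isPrincipal p hyP]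
  exact norm_logSeries_eq_zpow_envelope p hϖ hlo hhi hy

/-- `‖log_p(1 + x)‖ = ‖ϖ‖^{p^{a₀} − e·a₀}` for every `x` of norm `‖ϖ‖` (strict turning point).
[cite: NeukirchANT1999, Ch. II (5.5)] -/
theorem norm_unitLog_one_add_eq_zpow_envelope {a₀ : ℕ}
    (hlo : ∀ a < a₀, (p : ℤ) ^ a * ((p : ℤ) - 1) < absRamificationIdx p K)
    (hhi : (absRamificationIdx p K : ℤ) < (p : ℤ) ^ a₀ * ((p : ℤ) - 1)) {x : K} (hx : ‖x‖ = ‖(ϖ : K)‖) :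
    ‖unitLog (1 + x)‖ = ‖(ϖ : K)‖ ^ ((p : ℤ) ^ a₀ - (absRamificationIdx p K : ℤ) * (a₀ : ℤ)) := by
  refine norm_unitLog_eq_zpow_envelope p hϖ hlo hhi ?_
  rw [show (1 : K) - (1 + x) = -x by ring, norm_neg, hx]

/-- **`‖log_p(1 + ϖ)‖ = ‖ϖ‖^{p^{a₀} − e·a₀}`** (strict turning point; any norm uniformizer `ϖ`).
[cite: NeukirchANT1999, Ch. II (5.5)] -/
theorem norm_unitLog_one_add_unif_eq_zpow {a₀ : ℕ}
    (hlo : ∀ a < a₀, (p : ℤ) ^ a * ((p : ℤ) - 1) < absRamificationIdx p K)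
    (hhi : (absRamificationIdx p K : ℤ) < (p : ℤ) ^ a₀ * ((p : ℤ) - 1)) :
    ‖unitLog (1 + (ϖ : K))‖ = ‖(ϖ : K)‖ ^ ((p : ℤ) ^ a₀ - (absRamificationIdx p K : ℤ) * (a₀ : ℤ)) :=
  norm_unitLog_one_add_eq_zpow_envelope p hϖ hlo hhi rfl

omit instK [ProperSpace K] in
/-- `1 + ϖ` is a unit. [cite: NeukirchANT1999, Ch. II (5.3)] -/
theorem norm_one_add_unif : ‖1 + (ϖ : K)‖ = 1 := by
  have h : IsPrincipal (1 + (ϖ : K)) := by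
    show ‖1 - (1 + (ϖ : K))‖ < 1
    rw [show (1 : K) - (1 + ϖ) = -(ϖ : K) by ring, norm_neg]
    exact hϖ.1
  exact h.norm_eq_one

/-- **The envelope radius is ATTAINED on `log_p(𝒪_K^×)`** (strict turning point): `log_p(1 + ϖ)` has
norm `‖ϖ‖^{p^{a₀} − e·a₀}`. [cite: NeukirchANT1999, Ch. II (5.5)] -/
theorem exists_mem_logUnits_norm_eq_envelope {a₀ : ℕ}
    (hlo : ∀ a < a₀, (p : ℤ) ^ a * ((p : ℤ) - 1) < absRamificationIdx p K)
    (hhi : (absRamificationIdx p K : ℤ) < (p : ℤ) ^ a₀ * ((p : ℤ) - 1)) :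
    ∃ z ∈ logUnits K, ‖z‖ = ‖(ϖ : K)‖ ^ ((p : ℤ) ^ a₀ - (absRamificationIdx p K : ℤ) * (a₀ : ℤ)) :=
  ⟨unitLog (1 + (ϖ : K)), unitLog_mem_logUnits (norm_one_add_unif hϖ),
    norm_unitLog_one_add_unif_eq_zpow p hϖ hlo hhi⟩

/-- **The largest norm on `log_p(𝒪_K^×)` is `‖ϖ‖^{p^{a₀} − e·a₀}`** (strict turning point):
`IsGreatest`. [cite: NeukirchANT1999, Ch. II (5.5)] -/
theorem isGreatest_norm_logUnits {a₀ : ℕ}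
    (hlo : ∀ a < a₀, (p : ℤ) ^ a * ((p : ℤ) - 1) < absRamificationIdx p K)
    (hhi : (absRamificationIdx p K : ℤ) < (p : ℤ) ^ a₀ * ((p : ℤ) - 1)) :
    IsGreatest ((fun z : K => ‖z‖) '' logUnits K)
      (‖(ϖ : K)‖ ^ ((p : ℤ) ^ a₀ - (absRamificationIdx p K : ℤ) * (a₀ : ℤ))) := by
  obtain ⟨z, hz, hzn⟩ := exists_mem_logUnits_norm_eq_envelope p hϖ hlo hhi
  refine ⟨⟨z, hz, hzn⟩, ?_⟩
  rintro r ⟨w, hw, rfl⟩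
  exact forall_mem_logUnits_norm_le_envelope p hϖ hlo hhi.le w hw

/-- `sup ‖·‖` over `log_p(𝒪_K^×)` equals `‖ϖ‖^{p^{a₀} − e·a₀}` (strict turning point).
[cite: NeukirchANT1999, Ch. II (5.5)] -/
theorem sSup_norm_logUnits {a₀ : ℕ}
    (hlo : ∀ a < a₀, (p : ℤ) ^ a * ((p : ℤ) - 1) < absRamificationIdx p K)
    (hhi : (absRamificationIdx p K : ℤ) < (p : ℤ) ^ a₀ * ((p : ℤ) - 1)) :
    sSup ((fun z : K => ‖z‖) '' logUnits K)
      = ‖(ϖ : K)‖ ^ ((p : ℤ) ^ a₀ - (absRamificationIdx p K : ℤ) * (a₀ : ℤ)) :=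
  (isGreatest_norm_logUnits p hϖ hlo hhi).csSup_eq

/-- **An element of largest norm in `log_p(𝒪_K^×)` has norm `‖ϖ‖^{p^{a₀} − e·a₀}`** (strict turning
point) — the general form of abc-iut-w5-d082's `norm_eq_of_isMaxOn_logUnits_of_tame`.
[cite: NeukirchANT1999, Ch. II (5.5)] -/
theorem norm_eq_zpow_of_isMaxOn_logUnits {a₀ : ℕ}
    (hlo : ∀ a < a₀, (p : ℤ) ^ a * ((p : ℤ) - 1) < absRamificationIdx p K)
    (hhi : (absRamificationIdx p K : ℤ) < (p : ℤ) ^ a₀ * ((p : ℤ) - 1)) {z : K} (hzmem : z ∈ logUnits K)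
    (hz : ∀ w ∈ logUnits K, ‖w‖ ≤ ‖z‖) :
    ‖z‖ = ‖(ϖ : K)‖ ^ ((p : ℤ) ^ a₀ - (absRamificationIdx p K : ℤ) * (a₀ : ℤ)) := by
  obtain ⟨z₀, hz₀, hz₀n⟩ := exists_mem_logUnits_norm_eq_envelope p hϖ hlo hhi
  exact le_antisymm (forall_mem_logUnits_norm_le_envelope p hϖ hlo hhi.le z hzmem) (hz₀n ▸ hz z₀ hz₀)

/-- The same in `p^{−λ}` form: `‖z^max‖ = p^{−(p^{a₀} − e·a₀)/e}` (strict turning point).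
[cite: NeukirchANT1999, Ch. II (5.5)] -/
theorem norm_eq_rpow_of_isMaxOn_logUnits {a₀ : ℕ}
    (hlo : ∀ a < a₀, (p : ℤ) ^ a * ((p : ℤ) - 1) < absRamificationIdx p K)
    (hhi : (absRamificationIdx p K : ℤ) < (p : ℤ) ^ a₀ * ((p : ℤ) - 1)) {z : K} (hzmem : z ∈ logUnits K)
    (hz : ∀ w ∈ logUnits K, ‖w‖ ≤ ‖z‖) :
    ‖z‖ = (p : ℝ) ^ (-((((p : ℤ) ^ a₀ - (absRamificationIdx p K : ℤ) * (a₀ : ℤ) : ℤ) : ℝ)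
      / (absRamificationIdx p K : ℝ))) := by
  have hp0 : (0 : ℝ) ≤ p := by positivity
  rw [norm_eq_zpow_of_isMaxOn_logUnits p hϖ hlo hhi hzmem hz, norm_eq_rpow_of_isUniformizer p K hϖ,
    ← Real.rpow_intCast, ← Real.rpow_mul hp0]
  congr 1
  ring

/-- **`log_p(𝒪_K^×) ⊆ {‖z‖ ≤ r} ⟺ ‖ϖ‖^{p^{a₀} − e·a₀} ≤ r`** (strict turning point): the envelope
radius is the least admissible radius. [cite: NeukirchANT1999, Ch. II (5.5)] -/
theorem logUnits_subset_closedBall_iff {a₀ : ℕ}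
    (hlo : ∀ a < a₀, (p : ℤ) ^ a * ((p : ℤ) - 1) < absRamificationIdx p K)
    (hhi : (absRamificationIdx p K : ℤ) < (p : ℤ) ^ a₀ * ((p : ℤ) - 1)) {r : ℝ} :
    logUnits K ⊆ closedBall (0 : K) r ↔
      ‖(ϖ : K)‖ ^ ((p : ℤ) ^ a₀ - (absRamificationIdx p K : ℤ) * (a₀ : ℤ)) ≤ r := by
  constructor
  · intro h
    obtain ⟨z, hz, hzn⟩ := exists_mem_logUnits_norm_eq_envelope p hϖ hlo hhi
    rw [← hzn]
    exact mem_closedBall_zero_iff.mp (h hz)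
  · intro h
    exact (logUnits_subset_closedBall_envelope p hϖ hlo hhi.le).trans (closedBall_subset_closedBall h)

/-- **Off the cyclotomic indices the maximum is attained at SOME turning point**, unconditionally in the
shape of `e`: if `e(K/ℚ_p) ≠ p^a·(p−1)` for all `a`, there is `a₀` (the strict turning point) with
`IsGreatest (‖·‖ '' log_p(𝒪_K^×)) (‖ϖ‖^{p^{a₀} − e·a₀})`. [cite: NeukirchANT1999, Ch. II (5.5)] -/
theorem exists_isGreatest_norm_logUnits_of_forall_ne
    (hne : ∀ a : ℕ, (absRamificationIdx p K : ℤ) ≠ (p : ℤ) ^ a * ((p : ℤ) - 1)) :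
    ∃ a₀ : ℕ, (∀ a < a₀, (p : ℤ) ^ a * ((p : ℤ) - 1) < absRamificationIdx p K) ∧
      (absRamificationIdx p K : ℤ) < (p : ℤ) ^ a₀ * ((p : ℤ) - 1) ∧
      IsGreatest ((fun z : K => ‖z‖) '' logUnits K)
        (‖(ϖ : K)‖ ^ ((p : ℤ) ^ a₀ - (absRamificationIdx p K : ℤ) * (a₀ : ℤ))) := by
  obtain ⟨a₀, hlo, hhi⟩ := exists_strict_turning_of_forall_ne (p := p) hne
  exact ⟨a₀, hlo, hhi, isGreatest_norm_logUnits p hϖ hlo hhi⟩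

/-! ### §4. The two lowest turning points in closed form -/

/-- **`e ≤ p − 1` ⇒ `‖log_p u‖ ≤ ‖ϖ‖`** (turning point `0`, exponent `1`): the logarithm of a unit lies in
`𝔪_K` — abc-iut-w5-d172's `UnitLogIntoMaximalIdeal` re-derived from the envelope.
[cite: NeukirchANT1999, Ch. II (5.5)] -/
theorem norm_unitLog_le_norm_unif_of_le (he : absRamificationIdx p K ≤ p - 1) (u : K) :
    ‖unitLog u‖ ≤ ‖(ϖ : K)‖ := by
  have h := norm_unitLog_le_zpow_envelope p hϖ (turning_zero (p := p) he).1 (turning_zero (p := p) he).2 u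
  simpa using h

/-- **`e < p − 1` (tame) ⇒ the maximum `‖ϖ‖` is attained**: `IsGreatest (‖·‖ '' log_p(𝒪_K^×)) ‖ϖ‖`.
[cite: NeukirchANT1999, Ch. II (5.5)] -/
theorem isGreatest_norm_logUnits_of_lt (he : absRamificationIdx p K < p - 1) :
    IsGreatest ((fun z : K => ‖z‖) '' logUnits K) ‖(ϖ : K)‖ := by
  have h := isGreatest_norm_logUnits p hϖ (strict_turning_zero (p := p) he).1
    (strict_turning_zero (p := p) he).2
  simpa using h

/-- **`p − 1 < e ≤ p·(p−1)` ⇒ `‖log_p u‖ ≤ ‖ϖ‖^{p − e}`** (turning point `1`): e.g. `e = p` gives the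
bound `1`, `e = 11, p = 7` gives `‖ϖ‖^{−4} = 7^{4/11}`. [cite: NeukirchANT1999, Ch. II (5.5)] -/
theorem norm_unitLog_le_zpow_prime_sub (h1 : p - 1 < absRamificationIdx p K)
    (h2 : absRamificationIdx p K ≤ p * (p - 1)) (u : K) :
    ‖unitLog u‖ ≤ ‖(ϖ : K)‖ ^ ((p : ℤ) - absRamificationIdx p K) := by
  have h := norm_unitLog_le_zpow_envelope p hϖ (turning_one (p := p) h1 h2).1
    (turning_one (p := p) h1 h2).2 u
  simpa using h

/-- **`p − 1 < e < p·(p−1)` ⇒ `‖log_p(1 + ϖ)‖ = ‖ϖ‖^{p − e}`** (the term `ϖᵖ/p` dominates).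
[cite: NeukirchANT1999, Ch. II (5.5)] -/
theorem norm_unitLog_one_add_unif_eq_zpow_prime_sub (h1 : p - 1 < absRamificationIdx p K)
    (h2 : absRamificationIdx p K < p * (p - 1)) :
    ‖unitLog (1 + (ϖ : K))‖ = ‖(ϖ : K)‖ ^ ((p : ℤ) - absRamificationIdx p K) := by
  have h := norm_unitLog_one_add_unif_eq_zpow p hϖ (strict_turning_one (p := p) h1 h2).1
    (strict_turning_one (p := p) h1 h2).2
  simpa using h

/-- **`p − 1 < e < p·(p−1)` ⇒ the largest norm on `log_p(𝒪_K^×)` is `‖ϖ‖^{p − e} = p^{1 − p/e}`.**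
[cite: NeukirchANT1999, Ch. II (5.5)] -/
theorem isGreatest_norm_logUnits_of_lt_of_lt (h1 : p - 1 < absRamificationIdx p K)
    (h2 : absRamificationIdx p K < p * (p - 1)) :
    IsGreatest ((fun z : K => ‖z‖) '' logUnits K) (‖(ϖ : K)‖ ^ ((p : ℤ) - absRamificationIdx p K)) := by
  have h := isGreatest_norm_logUnits p hϖ (strict_turning_one (p := p) h1 h2).1
    (strict_turning_one (p := p) h1 h2).2
  simpa using h

/-- … in the radius form consumed downstream: `∀ w ∈ log_p(𝒪_K^×), ‖w‖ ≤ ‖ϖ‖^{p − e}` for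
`p − 1 < e ≤ p·(p−1)`. [cite: NeukirchANT1999, Ch. II (5.5)] -/
theorem forall_mem_logUnits_norm_le_zpow_prime_sub (h1 : p - 1 < absRamificationIdx p K)
    (h2 : absRamificationIdx p K ≤ p * (p - 1)) :
    ∀ w ∈ logUnits K, ‖w‖ ≤ ‖(ϖ : K)‖ ^ ((p : ℤ) - absRamificationIdx p K) := by
  rintro w ⟨u, -, rfl⟩
  exact norm_unitLog_le_zpow_prime_sub p hϖ h1 h2 u

end Field

end LogEnvelope

end Literature.IUT.LogVolume

end
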